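import Literature.MathematicalPhysics.QuantumFieldTheory.OSTimeTubeUniqueness
import Literature.MathematicalPhysics.QuantumFieldTheory.OSTimeTubeIntegrability
import HarnessLib

/-!
# Coordinates on the Osterwalder–Schrader time tube: complex times and real space

Support file (everything proved; no named facts) for the Osterwalder–Schrader continuation
theorems of `Literature.MathematicalPhysics.QuantumFieldTheory.OSTimeContinuation`. The *time
tube* `timeTube d n = {z ∈ (ℂ^{1+d})ⁿ | Im z⃗_k = 0, Im (z⁰_k − z⁰_{k-1}) > 0}` of that file is not
an open subset of `(ℂ^{1+d})ⁿ`; it is the image of the open set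
`𝒯ₙ × (ℝ^d)ⁿ ⊆ ℂⁿ × (ℝ^d)ⁿ` under the map `(w, y) ↦ (w_k, y⃗_k)_k` — these are the variables
`S_k(ζ⁰ | ξ⃗)`, "analytic in `ζ⁰ ∈ ℂ₊^k`, continuous in `ξ⃗ ∈ ℝ^{3k}`", of Osterwalder–Schrader II
(Comm. Math. Phys. 42 (1975), Thm. 4.3). This file sets up these coordinates once:

* `cTimeTube n = {w ∈ ℂⁿ | Im (w_k − w_{k-1}) > 0}` (open, convex), `tsCfg w y` (the point
  configuration with complex times `w` and real spatial parts `y`), `timeDir v = tsCfg v 0`;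
  `tsCfg w y ∈ timeTube d n ↔ w ∈ cTimeTube n`, `withTimes (tsCfg w y) w' = tsCfg w' y`, and the
  reconstruction `tsCfg (timesOf z) (spaceOf z) = z` of a point of the time tube;
* reparametrisation of the hypotheses of `OSTimeContinuation`: a time-holomorphic `𝔚` gives
  holomorphic functions `w ↦ 𝔚 (tsCfg w y)` on `cTimeTube n`
  (`IsTimeHolomorphicOn.differentiableOn_tsCfg`), a continuous `𝔚` a jointly continuous
  `(w, y) ↦ 𝔚 (tsCfg w y)` (`ContinuousOn.tsCfg`);
* Euclidean points and temporal rays in these coordinates (`euclideanPoint_tsReal`,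
  `rayC_eq_tsCfg`): imaginary times `imagTimes u = (i u_k)_k`, ordered positive times
  `orderedTimes n`;
* **the identity theorem on `cTimeTube n` from imaginary points**
  (`eqOn_zero_cTimeTube_of_imagTimes`: a holomorphic function on `𝒯ₙ` vanishing at the points
  `i u`, `u` ordered, vanishes — the one-variable identity theorem on the complex line
  `t ↦ i (Im w + t Re w)` through `w = γ(−i)`, as in the tree's
  `eqOn_zero_forwardTube_of_euclidean`), and its consequence for the time tube,
  **`eqOn_timeTube_of_euclidean`**: two time-holomorphic functions on the time tube which agree at
  all time-ordered Euclidean points agree on the time tube (Osterwalder–Schrader's "the `S_k(ζ⁰|ξ⃗)`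
  are determined by their values at Euclidean points"; Streater–Wightman (1964), §2-3, real
  environments).

## References

* K. Osterwalder, R. Schrader, *Axioms for Euclidean Green's functions II*, Comm. Math. Phys. 42
  (1975) 281–305, §IV.2 Thm. 4.3. [OsterwalderSchraderCMP1975]
* R. F. Streater, A. S. Wightman, *PCT, Spin and Statistics, and All That* (1964), §2-3.
  [StreaterWightman1964]
-/

noncomputable section

open Filter Complex Set
open scoped Topology
open Literature.MathematicalPhysics.QuantumLattice

namespace Literature.MathematicalPhysics.QuantumFieldTheory

variable {d n : ℕ}

/-! ### The complex time tube `𝒯ₙ ⊆ ℂⁿ` -/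

variable (n) in
/-- The **complex time tube** `𝒯ₙ = {w ∈ ℂⁿ | Im w₀ > 0, Im (w_k − w_{k-1}) > 0}`: the `n`
complex times of the points of `timeTube d n` (OS II's `ℂ₊^k` in the difference variables
`ζ⁰_k = −i (w_k − w_{k-1})`). [cite: OsterwalderSchraderCMP1975, §IV.2 Thm. 4.3] -/
def cTimeTube : Set (Fin n → ℂ) := {w | ∀ k, 0 < (succDiff w k).im}

/-- Membership in the complex time tube. [folklore] -/
theorem mem_cTimeTube_iff (w : Fin n → ℂ) : w ∈ cTimeTube n ↔ ∀ k, 0 < (succDiff w k).im :=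
  Iff.rfl

/-- Continuity of `w ↦ w_k − w_{k-1}` on `ℂⁿ`. [folklore] -/
theorem continuous_succDiff_complex (k : Fin n) : Continuous fun w : Fin n → ℂ => succDiff w k := by
  cases n with
  | zero => exact k.elim0
  | succ m =>
    refine Fin.cases ?_ (fun j => ?_) k
    · simp only [succDiff_zero]; exact continuous_apply _
    · simp only [succDiff_succ]; exact (continuous_apply _).sub (continuous_apply _)

/-- The complex time tube is open. [folklore] -/
theorem isOpen_cTimeTube : IsOpen (cTimeTube n) := by
  simp only [cTimeTube, setOf_forall]
  exact isOpen_iInter_of_finite fun k =>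
    isOpen_lt continuous_const (continuous_im.comp (continuous_succDiff_complex k))

/-- The complex time tube is convex. [folklore] -/
theorem convex_cTimeTube : Convex ℝ (cTimeTube n) := by
  intro w hw w' hw' a b ha hb hab k
  rw [succDiff_add, succDiff_smul, succDiff_smul, add_im, real_smul, real_smul,
    mul_im, mul_im, ofReal_re, ofReal_im, ofReal_re, ofReal_im, zero_mul, add_zero, zero_mul,
    add_zero]
  rcases ha.lt_or_eq with ha' | rfl
  · exact add_pos_of_pos_of_nonneg (mul_pos ha' (hw k)) (mul_nonneg hb (hw' k).le)
  · rw [zero_add] at hab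
    rw [hab, zero_mul, zero_add, one_mul]
    exact hw' k

/-- Adding real numbers to the times does not leave the complex time tube. [folklore] -/
theorem add_ofReal_mem_cTimeTube {w : Fin n → ℂ} (hw : w ∈ cTimeTube n) (r : Fin n → ℝ) :
    (fun k => w k + (r k : ℂ)) ∈ cTimeTube n := by
  intro k
  have h : (fun k => w k + (r k : ℂ)) = w + fun k => (r k : ℂ) := rfl
  rw [h, succDiff_add, add_im, succDiff_map (fun t : ℝ => (t : ℂ)) (fun a b => by push_cast; ring),
    ofReal_im, add_zero]
  exact hw k

/-! ### Configurations from complex times and real spatial parts -/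

/-- The point configuration with complex times `w` and real spatial parts `y`:
`(tsCfg w y)_k = (w_k, y_k¹, …, y_k^d)`. [folklore] -/
def tsCfg (w : Fin n → ℂ) (y : Fin n → EuclideanSpace ℝ (Fin d)) : Fin n → Fin (d + 1) → ℂ :=
  fun k => Fin.cons (w k) fun i => ((y k i : ℝ) : ℂ)

/-- Time components of `tsCfg`. [folklore] -/
@[simp]
theorem tsCfg_apply_zero (w : Fin n → ℂ) (y : Fin n → EuclideanSpace ℝ (Fin d)) (k : Fin n) :
    tsCfg w y k 0 = w k := by
  simp [tsCfg]

/-- Space components of `tsCfg`. [folklore] -/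
@[simp]
theorem tsCfg_apply_succ (w : Fin n → ℂ) (y : Fin n → EuclideanSpace ℝ (Fin d)) (k : Fin n)
    (i : Fin d) : tsCfg w y k i.succ = ((y k i : ℝ) : ℂ) := by
  simp [tsCfg]

/-- **`tsCfg w y` lies in the time tube iff `w ∈ 𝒯ₙ`** (its spatial parts are real). [folklore] -/
theorem tsCfg_mem_timeTube_iff (w : Fin n → ℂ) (y : Fin n → EuclideanSpace ℝ (Fin d)) :
    tsCfg w y ∈ timeTube d n ↔ w ∈ cTimeTube n := by
  rw [mem_timeTube_iff, mem_cTimeTube_iff]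
  simp only [tsCfg_apply_succ, ofReal_im, implies_true, true_and, tsCfg_apply_zero]

/-- The times of a point configuration. [folklore] -/
def timesOf (z : Fin n → Fin (d + 1) → ℂ) : Fin n → ℂ := fun k => z k 0

/-- The (real parts of the) spatial parts of a point configuration. [folklore] -/
def spaceOf (z : Fin n → Fin (d + 1) → ℂ) : Fin n → EuclideanSpace ℝ (Fin d) :=
  fun k => WithLp.toLp 2 fun i => (z k i.succ).re

/-- Components of `timesOf`. [folklore] -/
@[simp]
theorem timesOf_apply (z : Fin n → Fin (d + 1) → ℂ) (k : Fin n) : timesOf z k = z k 0 := rfl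

/-- Components of `spaceOf`. [folklore] -/
@[simp]
theorem spaceOf_apply (z : Fin n → Fin (d + 1) → ℂ) (k : Fin n) (i : Fin d) :
    spaceOf z k i = (z k i.succ).re := rfl

/-- `timesOf (tsCfg w y) = w`. [folklore] -/
@[simp]
theorem timesOf_tsCfg (w : Fin n → ℂ) (y : Fin n → EuclideanSpace ℝ (Fin d)) :
    timesOf (tsCfg w y) = w := funext fun k => tsCfg_apply_zero w y k

/-- `spaceOf (tsCfg w y) = y`. [folklore] -/
@[simp]
theorem spaceOf_tsCfg (w : Fin n → ℂ) (y : Fin n → EuclideanSpace ℝ (Fin d)) :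
    spaceOf (tsCfg w y) = y := by
  funext k; ext i; simp

/-- **A configuration with real spatial parts is `tsCfg` of its times and spatial parts.** [folklore] -/
theorem tsCfg_timesOf_spaceOf {z : Fin n → Fin (d + 1) → ℂ} (hz : ∀ (k : Fin n) (i : Fin d), (z k i.succ).im = 0) :
    tsCfg (timesOf z) (spaceOf z) = z := by
  funext k μ
  refine Fin.cases ?_ (fun i => ?_) μ
  · simp
  · rw [tsCfg_apply_succ, spaceOf_apply]
    exact Complex.ext (by simp) (by simp [hz k i])

/-- The times of a point of the time tube lie in the complex time tube. [folklore] -/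
theorem timesOf_mem_cTimeTube {z : Fin n → Fin (d + 1) → ℂ} (hz : z ∈ timeTube d n) :
    timesOf z ∈ cTimeTube n := hz.2

/-- Replacing the times of `tsCfg w y` by `w'` gives `tsCfg w' y`. [folklore] -/
@[simp]
theorem withTimes_tsCfg (w w' : Fin n → ℂ) (y : Fin n → EuclideanSpace ℝ (Fin d)) :
    withTimes (tsCfg w y) w' = tsCfg w' y := by
  funext k μ
  by_cases hμ : μ = 0
  · subst hμ; simp
  · obtain ⟨i, rfl⟩ := Fin.exists_succ_eq.2 hμ
    simp

/-- For a configuration with real spatial parts, `withTimes z w = tsCfg w (spaceOf z)`. [folklore] -/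
theorem withTimes_eq_tsCfg {z : Fin n → Fin (d + 1) → ℂ} (hz : ∀ (k : Fin n) (i : Fin d), (z k i.succ).im = 0)
    (w : Fin n → ℂ) : withTimes z w = tsCfg w (spaceOf z) := by
  conv_lhs => rw [← tsCfg_timesOf_spaceOf hz]
  exact withTimes_tsCfg _ _ _

/-- The **time direction** attached to `v ∈ ℂⁿ`: the configuration with times `v` and vanishing
spatial parts. [folklore] -/
def timeDir (v : Fin n → ℂ) : Fin n → Fin (d + 1) → ℂ := tsCfg v 0

/-- Time components of `timeDir`. [folklore] -/
@[simp]
theorem timeDir_apply_zero (v : Fin n → ℂ) (k : Fin n) : (timeDir v : Fin n → Fin (d + 1) → ℂ) k 0 = v k :=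
  tsCfg_apply_zero v 0 k

/-- Space components of `timeDir` vanish. [folklore] -/
@[simp]
theorem timeDir_apply_succ (v : Fin n → ℂ) (k : Fin n) (i : Fin d) :
    (timeDir v : Fin n → Fin (d + 1) → ℂ) k i.succ = 0 := by
  simp [timeDir]

/-- Shifting the times: `tsCfg (w + v) y = tsCfg w y + timeDir v`. [folklore] -/
theorem tsCfg_add_left (w v : Fin n → ℂ) (y : Fin n → EuclideanSpace ℝ (Fin d)) :
    tsCfg (w + v) y = tsCfg w y + timeDir v := by
  funext k μ
  refine Fin.cases ?_ (fun i => ?_) μ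
  · simp
  · simp

/-- The complex line in a time direction: `tsCfg (w + ζ v) y = tsCfg w y + ζ • timeDir v`. [folklore] -/
theorem tsCfg_add_smul_left (w v : Fin n → ℂ) (ζ : ℂ) (y : Fin n → EuclideanSpace ℝ (Fin d)) :
    tsCfg (w + ζ • v) y = tsCfg w y + ζ • timeDir v := by
  funext k μ
  refine Fin.cases ?_ (fun i => ?_) μ
  · simp
  · simp

/-- `tsCfg` is jointly continuous. [folklore] -/
theorem continuous_tsCfg :
    Continuous fun p : (Fin n → ℂ) × (Fin n → EuclideanSpace ℝ (Fin d)) => tsCfg p.1 p.2 := by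
  refine continuous_pi fun k => continuous_pi fun μ => ?_
  refine Fin.cases ?_ (fun i => ?_) μ
  · simp only [tsCfg_apply_zero]
    exact (continuous_apply k).comp continuous_fst
  · simp only [tsCfg_apply_succ]
    exact continuous_ofReal.comp
      ((EuclideanSpace.proj i).continuous.comp ((continuous_apply k).comp continuous_snd))

/-- `tsCfg w y` is continuous in the spatial parts. [folklore] -/
theorem continuous_tsCfg_right (w : Fin n → ℂ) :
    Continuous fun y : Fin n → EuclideanSpace ℝ (Fin d) => tsCfg w y :=
  continuous_tsCfg.comp (continuous_const.prodMk continuous_id)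

/-- `tsCfg w y` is continuous in the times. [folklore] -/
theorem continuous_tsCfg_left (y : Fin n → EuclideanSpace ℝ (Fin d)) :
    Continuous fun w : Fin n → ℂ => tsCfg w y :=
  continuous_tsCfg.comp (continuous_id.prodMk continuous_const)

/-- `tsCfg w y` is complex differentiable (affine) in the times. [folklore] -/
theorem differentiable_tsCfg_left (y : Fin n → EuclideanSpace ℝ (Fin d)) :
    Differentiable ℂ fun w : Fin n → ℂ => tsCfg w y := by
  refine differentiable_pi.2 fun k => differentiable_pi.2 fun μ => ?_
  refine Fin.cases ?_ (fun i => ?_) μ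
  · simp only [tsCfg_apply_zero]
    exact differentiable_apply (𝕜 := ℂ) k
  · simp only [tsCfg_apply_succ]
    exact differentiable_const _

/-! ### Reparametrisation of the hypotheses of `OSTimeContinuation` -/

/-- **A time-holomorphic function on the time tube is holomorphic in the complex times**:
`w ↦ 𝔚 (tsCfg w y)` is holomorphic on `𝒯ₙ` for every real spatial configuration `y`. [folklore] -/
theorem IsTimeHolomorphicOn.differentiableOn_tsCfg {𝔚 : (Fin n → Fin (d + 1) → ℂ) → ℂ}
    (h : IsTimeHolomorphicOn 𝔚 (timeTube d n)) (y : Fin n → EuclideanSpace ℝ (Fin d)) :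
    DifferentiableOn ℂ (fun w => 𝔚 (tsCfg w y)) (cTimeTube n) := by
  intro w hw
  have hz : tsCfg w y ∈ timeTube d n := (tsCfg_mem_timeTube_iff w y).2 hw
  have h' := h _ hz
  simp only [withTimes_tsCfg, tsCfg_mem_timeTube_iff] at h'
  exact h' w hw

/-- **A continuous function on the time tube is jointly continuous in complex times and real
space** on `𝒯ₙ × (ℝ^d)ⁿ`. [folklore] -/
theorem _root_.ContinuousOn.tsCfg {E : Type*} [TopologicalSpace E]
    {𝔚 : (Fin n → Fin (d + 1) → ℂ) → E} (h : ContinuousOn 𝔚 (timeTube d n)) :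
    ContinuousOn (fun p : (Fin n → ℂ) × (Fin n → EuclideanSpace ℝ (Fin d)) => 𝔚 (tsCfg p.1 p.2))
      (cTimeTube n ×ˢ univ) :=
  h.comp continuous_tsCfg.continuousOn fun p hp => (tsCfg_mem_timeTube_iff p.1 p.2).2 hp.1

/-- At fixed times in `𝒯ₙ`, a continuous function on the time tube is continuous in space. [folklore] -/
theorem _root_.ContinuousOn.tsCfg_space {E : Type*} [TopologicalSpace E]
    {𝔚 : (Fin n → Fin (d + 1) → ℂ) → E} (h : ContinuousOn 𝔚 (timeTube d n)) {w : Fin n → ℂ}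
    (hw : w ∈ cTimeTube n) : Continuous fun y : Fin n → EuclideanSpace ℝ (Fin d) => 𝔚 (tsCfg w y) :=
  h.comp_continuous (continuous_tsCfg_right w) fun y => (tsCfg_mem_timeTube_iff w y).2 hw

/-- At fixed spatial parts, a continuous function on the time tube is continuous in the times on
`𝒯ₙ`. [folklore] -/
theorem _root_.ContinuousOn.tsCfg_times {E : Type*} [TopologicalSpace E]
    {𝔚 : (Fin n → Fin (d + 1) → ℂ) → E} (h : ContinuousOn 𝔚 (timeTube d n))
    (y : Fin n → EuclideanSpace ℝ (Fin d)) :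
    ContinuousOn (fun w : Fin n → ℂ => 𝔚 (tsCfg w y)) (cTimeTube n) :=
  h.comp (continuous_tsCfg_left y).continuousOn fun w hw => (tsCfg_mem_timeTube_iff w y).2 hw

/-! ### Euclidean points and temporal rays -/

variable (n) in
/-- The **ordered positive times** `{u ∈ ℝⁿ | 0 < u₀ < u₁ < ⋯ < u_{n-1}}`, as positivity of the
successive differences. [folklore] -/
def orderedTimes : Set (Fin n → ℝ) := {u | ∀ k, 0 < succDiff u k}

/-- Membership in `orderedTimes`. [folklore] -/
theorem mem_orderedTimes_iff (u : Fin n → ℝ) : u ∈ orderedTimes n ↔ ∀ k, 0 < succDiff u k :=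
  Iff.rfl

/-- Continuity of `u ↦ u_k − u_{k-1}` on `ℝⁿ`. [folklore] -/
theorem continuous_succDiff_realTimes (k : Fin n) : Continuous fun u : Fin n → ℝ => succDiff u k := by
  cases n with
  | zero => exact k.elim0
  | succ m =>
    refine Fin.cases ?_ (fun j => ?_) k
    · simp only [succDiff_zero]; exact continuous_apply _
    · simp only [succDiff_succ]; exact (continuous_apply _).sub (continuous_apply _)

/-- The set of ordered positive times is open. [folklore] -/
theorem isOpen_orderedTimes : IsOpen (orderedTimes n) := by
  simp only [orderedTimes, setOf_forall]
  exact isOpen_iInter_of_finite fun k =>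
    isOpen_lt continuous_const (continuous_succDiff_realTimes k)

/-- **Imaginary times** `(i u_k)_k` of real times `u`. [folklore] -/
def imagTimes (u : Fin n → ℝ) : Fin n → ℂ := fun k => I * (u k : ℂ)

/-- Components of `imagTimes`. [folklore] -/
@[simp]
theorem imagTimes_apply (u : Fin n → ℝ) (k : Fin n) : imagTimes u k = I * (u k : ℂ) := rfl

/-- `Im` of the successive differences of imaginary times. [folklore] -/
theorem im_succDiff_imagTimes (u : Fin n → ℝ) (k : Fin n) :
    (succDiff (imagTimes u) k).im = succDiff u k := by
  have h : imagTimes u = fun j => (fun t : ℝ => I * (t : ℂ)) (u j) := rfl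
  rw [h, succDiff_map (fun t : ℝ => I * (t : ℂ)) (fun a b => by push_cast; ring)]
  simp

/-- **Imaginary ordered times lie in the complex time tube.** [folklore] -/
theorem imagTimes_mem_cTimeTube_iff (u : Fin n → ℝ) : imagTimes u ∈ cTimeTube n ↔ u ∈ orderedTimes n := by
  simp only [mem_cTimeTube_iff, im_succDiff_imagTimes, mem_orderedTimes_iff]

/-- The Euclidean configuration with times `u` and spatial parts `y`. [folklore] -/
def tsReal (u : Fin n → ℝ) (y : Fin n → EuclideanSpace ℝ (Fin d)) :
    Fin n → EuclideanSpace ℝ (Fin (d + 1)) := fun k => ofTimeSpace (u k) (y k)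

/-- Time components of `tsReal`. [folklore] -/
@[simp]
theorem tsReal_apply_zero (u : Fin n → ℝ) (y : Fin n → EuclideanSpace ℝ (Fin d)) (k : Fin n) :
    tsReal u y k 0 = u k := rfl

/-- Space components of `tsReal`. [folklore] -/
@[simp]
theorem tsReal_apply_succ (u : Fin n → ℝ) (y : Fin n → EuclideanSpace ℝ (Fin d)) (k : Fin n)
    (i : Fin d) : tsReal u y k i.succ = y k i := by
  simp [tsReal]

/-- **Euclidean points in time–space coordinates**: `ι (tsReal u y) = tsCfg (i u) y`. [folklore] -/
theorem euclideanPoint_tsReal (u : Fin n → ℝ) (y : Fin n → EuclideanSpace ℝ (Fin d)) :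
    euclideanPoint (tsReal u y) = tsCfg (imagTimes u) y := by
  funext k μ
  refine Fin.cases ?_ (fun i => ?_) μ
  · simp
  · rw [euclideanPoint_apply_succ, tsCfg_apply_succ, tsReal_apply_succ]

/-- Every Euclidean point is of this form: `ι x = tsCfg (i x⁰) x⃗`. [folklore] -/
theorem euclideanPoint_eq_tsCfg (x : Fin n → EuclideanSpace ℝ (Fin (d + 1))) :
    euclideanPoint x = tsCfg (imagTimes fun k => x k 0) (fun k => spaceC d (x k)) := by
  funext k μ
  refine Fin.cases ?_ (fun i => ?_) μ
  · simp
  · rw [euclideanPoint_apply_succ, tsCfg_apply_succ, spaceC_apply]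

/-- `tsReal u y` is time-ordered iff `u` is ordered and positive. [folklore] -/
theorem tsReal_mem_timeOrderedRegion_iff (u : Fin n → ℝ) (y : Fin n → EuclideanSpace ℝ (Fin d)) :
    tsReal u y ∈ timeOrderedRegion d n ↔ u ∈ orderedTimes n :=
  ⟨fun h k => succDiff_pos_of_mem_timeOrderedRegion h k,
    fun h => mem_timeOrderedRegion_of_succDiff_pos fun k => h k⟩

/-- The times of a time-ordered configuration are ordered and positive. [folklore] -/
theorem times_mem_orderedTimes_of_mem_timeOrderedRegion {x : Fin n → EuclideanSpace ℝ (Fin (d + 1))}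
    (hx : x ∈ timeOrderedRegion d n) : (fun k => x k 0) ∈ orderedTimes n :=
  fun k => succDiff_pos_of_mem_timeOrderedRegion hx k

/-- **Temporal rays in time–space coordinates**: for `η` in the temporal cone,
`x + λη = tsCfg (x⁰_k + λ η⁰_k)_k x⃗`. [folklore] -/
theorem rayC_eq_tsCfg (x : Fin n → SpaceTime d) {η : Fin n → SpaceTime d}
    (hη : η ∈ temporalCone d n) (l : ℂ) :
    rayC x η l = tsCfg (fun k => (x k 0 : ℂ) + l * (η k 0 : ℂ)) (fun k => spaceC d (x k)) := by
  funext k μ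
  refine Fin.cases ?_ (fun i => ?_) μ
  · simp [rayC_apply]
  · simp [rayC_apply, hη.2 k i]

/-- The times `x⁰_k + λ η⁰_k` of a temporal ray lie in `𝒯ₙ` for `Im λ > 0`. [folklore] -/
theorem rayTimes_mem_cTimeTube (x : Fin n → SpaceTime d) {η : Fin n → SpaceTime d}
    (hη : η ∈ temporalCone d n) {l : ℂ} (hl : 0 < l.im) :
    (fun k => (x k 0 : ℂ) + l * (η k 0 : ℂ)) ∈ cTimeTube n := by
  have h := rayC_mem_timeTube x hη hl
  rw [rayC_eq_tsCfg x hη l, tsCfg_mem_timeTube_iff] at h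
  exact h

/-! ### The identity theorem on `𝒯ₙ` from imaginary points -/

/-- **Identity theorem for the complex time tube from imaginary points.** A holomorphic function
on `𝒯ₙ` which vanishes at all points `i u` with `u` ordered and positive vanishes on `𝒯ₙ`: through
`w ∈ 𝒯ₙ` passes the complex line `γ(t) = i (Im w + t Re w)`, whose real points near `t = 0` are
such imaginary points and with `γ(−i) = w`; the set of parameters mapped into `𝒯ₙ` is open,
convex and contains `0` and `−i`, so the one-variable identity theorem applies (Streater–Wightman
(1964), §2-3: a holomorphic function is determined by its values on a real environment). [cite: StreaterWightman1964, §2-3] -/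
theorem eqOn_zero_cTimeTube_of_imagTimes {g : (Fin n → ℂ) → ℂ}
    (hg : DifferentiableOn ℂ g (cTimeTube n))
    (h0 : ∀ u ∈ orderedTimes n, g (imagTimes u) = 0) : EqOn g 0 (cTimeTube n) := by
  intro w hw
  set a : Fin n → ℝ := fun k => (w k).im with ha_def
  set b : Fin n → ℝ := fun k => (w k).re with hb_def
  have ha : a ∈ orderedTimes n := fun k => by
    have h := hw k
    rwa [← succDiff_map Complex.im Complex.sub_im] at h
  -- the complex line `t ↦ i (a + t b)`
  set γ : ℂ → (Fin n → ℂ) := fun t k => I * ((a k : ℂ) + t * (b k : ℂ)) with hγ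
  have hγd : Differentiable ℂ γ := differentiable_pi.2 fun k =>
    (differentiable_const _).mul ((differentiable_const _).add (differentiable_id.mul_const _))
  have hγw : γ (-I) = w := by
    funext k
    simp only [hγ]
    rw [show I * ((a k : ℂ) + -I * (b k : ℂ)) = (b k : ℂ) + (a k : ℂ) * I by ring_nf; rw [I_sq]; ring]
    exact re_add_im (w k)
  have hγreal : ∀ t : ℝ, γ (t : ℂ) = imagTimes (a + t • b) := fun t => by
    funext k
    simp only [hγ, imagTimes_apply, Pi.add_apply, Pi.smul_apply, smul_eq_mul]
    push_cast
    ring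
  set D : Set ℂ := γ ⁻¹' cTimeTube n with hD
  have hDo : IsOpen D := isOpen_cTimeTube.preimage hγd.continuous
  have hDc : Convex ℝ D := by
    intro s hs t ht α β hα hβ hαβ
    show γ (α • s + β • t) ∈ cTimeTube n
    have hαβ' : (α : ℂ) + β = 1 := by exact_mod_cast hαβ
    have : γ (α • s + β • t) = α • γ s + β • γ t := by
      funext k
      simp only [hγ, Pi.add_apply, Pi.smul_apply, Complex.real_smul]
      linear_combination (I * (a k : ℂ)) * hαβ'.symm
    rw [this]
    exact convex_cTimeTube hs ht hα hβ hαβ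
  have h0D : (0 : ℂ) ∈ D := by
    show γ 0 ∈ cTimeTube n
    have : γ 0 = imagTimes a := by simpa using hγreal 0
    rw [this, imagTimes_mem_cTimeTube_iff]
    exact ha
  have hID : -I ∈ D := by
    show γ (-I) ∈ cTimeTube n
    rw [hγw]; exact hw
  have hφ : AnalyticOnNhd ℂ (g ∘ γ) D :=
    (hg.comp hγd.differentiableOn (mapsTo_preimage γ _)).analyticOnNhd hDo
  have hreal : ∀ᶠ t : ℝ in 𝓝 0, (g ∘ γ) (t : ℂ) = 0 := by
    have hcont : Continuous fun t : ℝ => a + t • b :=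
      continuous_const.add (continuous_id.smul continuous_const)
    have hmem : ∀ᶠ t : ℝ in 𝓝 0, a + t • b ∈ orderedTimes n := by
      refine hcont.continuousAt.eventually_mem (isOpen_orderedTimes.mem_nhds ?_)
      simpa using ha
    filter_upwards [hmem] with t ht
    simp only [Function.comp_apply, hγreal t]
    exact h0 _ ht
  have hfreq : ∃ᶠ t in 𝓝[≠] (0 : ℂ), (g ∘ γ) t = 0 := by
    have htend : Tendsto (fun t : ℝ => (t : ℂ)) (𝓝[≠] 0) (𝓝[≠] 0) := by
      refine continuous_ofReal.continuousWithinAt.tendsto_nhdsWithin ?_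
      intro t ht
      simpa using ht
    exact htend.frequently (eventually_nhdsWithin_of_eventually_nhds hreal).frequently
  have := hφ.eqOn_zero_of_preconnected_of_frequently_eq_zero hDc.isPreconnected h0D hfreq hID
  simpa only [Function.comp_apply, hγw, Pi.zero_apply] using this

/-- Two holomorphic functions on `𝒯ₙ` which agree at all imaginary ordered times agree on `𝒯ₙ`. [cite: StreaterWightman1964, §2-3] -/
theorem eqOn_cTimeTube_of_imagTimes {g g' : (Fin n → ℂ) → ℂ}
    (hg : DifferentiableOn ℂ g (cTimeTube n)) (hg' : DifferentiableOn ℂ g' (cTimeTube n))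
    (heq : ∀ u ∈ orderedTimes n, g (imagTimes u) = g' (imagTimes u)) :
    EqOn g g' (cTimeTube n) := by
  intro w hw
  have := eqOn_zero_cTimeTube_of_imagTimes (hg.sub hg') (fun u hu => by simp [heq u hu]) hw
  simpa [sub_eq_zero] using this

/-- **Identity theorem for the time tube from Euclidean points, time-holomorphic version.** Two
functions on `(ℂ^{1+d})ⁿ` which are holomorphic in the times on the time tube and agree at all
time-ordered Euclidean points agree on the whole time tube (apply
`eqOn_cTimeTube_of_imagTimes` at fixed spatial parts; Osterwalder–Schrader's `S_k(ζ⁰ | ξ⃗)` are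
determined by the Euclidean Green's functions). [cite: OsterwalderSchraderCMP1975, §IV.2 Thm. 4.3] -/
theorem eqOn_timeTube_of_euclidean {𝔚 𝔚' : (Fin n → Fin (d + 1) → ℂ) → ℂ}
    (h : IsTimeHolomorphicOn 𝔚 (timeTube d n)) (h' : IsTimeHolomorphicOn 𝔚' (timeTube d n))
    (heq : ∀ x ∈ timeOrderedRegion d n, 𝔚 (euclideanPoint x) = 𝔚' (euclideanPoint x)) :
    EqOn 𝔚 𝔚' (timeTube d n) := by
  intro z hz
  have key := eqOn_cTimeTube_of_imagTimes (h.differentiableOn_tsCfg (spaceOf z))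
    (h'.differentiableOn_tsCfg (spaceOf z))
    (fun u hu => by
      have hx : tsReal u (spaceOf z) ∈ timeOrderedRegion d n :=
        (tsReal_mem_timeOrderedRegion_iff u _).2 hu
      have := heq _ hx
      rwa [euclideanPoint_tsReal] at this)
    (timesOf_mem_cTimeTube hz)
  simp only [tsCfg_timesOf_spaceOf hz.1] at key
  exact key

end Literature.MathematicalPhysics.QuantumFieldTheory
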